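import Summits.RiemannHypothesis.RiemannHypothesis.Theorems.SignConeEnvelopeCore
import Summits.RiemannHypothesis.RiemannHypothesis.Theses.SignCone

/-!
# The known envelope of the sign-cone cruxes (route `SignCone`, item stmt-RiemannHypothesis-16302)

Route-decl corollaries of `SignConeEnvelopeCore`: the unit-slack sign-cone inequality
`Re W_ar(F) ≥ -Re F(0)` on node-nonnegative `F = Σᵢ gᵢ ⋆ g̃ᵢ` — the route statements `SignConeInequality`,
`SignConeOscillatory` (item stmt-RiemannHypothesis-16302), `SignConeFarField` — follows from `WeilPositivity`,
hence from Mathlib's `RiemannHypothesis` (`WeilPositivity.of_riemannHypothesis explicit_formula_holds`); and the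
propositional bookkeeping `SignConeInequality ↔ SignConeOscillatory ∧ SignConeFarField` used by the route's
deciding theorem `closes`. The item's `M`-form is definitionally the Literature form
`-(F 0).re ≤ (weilPolarTerm F + weilArchTerm F).re` (route CONE NOTE, rev 3), which is what `exact` uses below.

These are SUPPORT lemmas for the crux `SignConeOscillatory`: they certify that the crux sits below `RH`
(no refutation short of `¬ RiemannHypothesis`) and isolate what an unconditional proof must add. They do not
close the item.
-/

noncomputable section

-- `Summit.RiemannHypothesis.RiemannHypothesis.…` repeats a namespace component by design (D-0017 layout).
set_option linter.dupNamespace false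

open scoped BigOperators ComplexConjugate Topology
open Complex MeasureTheory Set Filter

namespace Summit.RiemannHypothesis.RiemannHypothesis.Theorems.SignCone

open Literature.NumberTheory.LFunctions
open Summit.RiemannHypothesis.RiemannHypothesis.Theorems.RuelleBandCofiniteCriticalLine
open Summit.RiemannHypothesis.RiemannHypothesis.Theses.SignCone

/-! ## The route statements from Weil positivity and from RH -/

/-- `WeilPositivity → SignConeInequality`: the unit-slack sign-cone inequality on the whole sign cone
follows from Weil positivity (the item's `M`-form is definitionally the Literature form
`-(F 0).re ≤ (weilPolarTerm F + weilArchTerm F).re`). [folklore] -/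
theorem signConeInequality_of_weilPositivity (hWP : WeilPositivity) : SignConeInequality := by
  intro a _ha k g hg F hn M
  have hgi : ∀ i, IsWeilTest (g i) := fun i => (hg i).1
  exact neg_re_apply_zero_le_re_weilArchPolar (g := g) (F := F) rfl hgi
    (fun i => hWP _ (hgi i)) hn

/-- `SignConeInequality → SignConeOscillatory` (drop the oscillation hypothesis). [folklore] -/
theorem signConeOscillatory_of_signConeInequality (h : SignConeInequality) : SignConeOscillatory :=
  fun a ha k g hg hn _hosc => h a ha k g hg hn

/-- `SignConeInequality → SignConeFarField` (drop the far-field hypothesis). [folklore] -/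
theorem signConeFarField_of_signConeInequality (h : SignConeInequality) : SignConeFarField :=
  fun a ha k g hg hn _hff => h a ha k g hg hn

/-- `SignConeInequality ↔ SignConeOscillatory ∧ SignConeFarField`: the case split on the sign of `Re F`
beyond the first node used by the route's deciding theorem `closes`. [folklore] -/
theorem signConeInequality_iff :
    SignConeInequality ↔ SignConeOscillatory ∧ SignConeFarField := by
  refine ⟨fun h => ⟨signConeOscillatory_of_signConeInequality h,
    signConeFarField_of_signConeInequality h⟩, fun ⟨h₁, h₂⟩ => ?_⟩
  intro a ha k g hg F hn
  by_cases hff : ∀ t : ℝ, Real.log 2 ≤ |t| → 0 ≤ (F t).re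
  · exact h₂ a ha k g hg hn hff
  · push Not at hff
    exact h₁ a ha k g hg hn hff

/-- `WeilPositivity → SignConeOscillatory`. [folklore] -/
theorem signConeOscillatory_of_weilPositivity (hWP : WeilPositivity) : SignConeOscillatory :=
  signConeOscillatory_of_signConeInequality (signConeInequality_of_weilPositivity hWP)

/-- `WeilPositivity → SignConeFarField`. [folklore] -/
theorem signConeFarField_of_weilPositivity (hWP : WeilPositivity) : SignConeFarField :=
  signConeFarField_of_signConeInequality (signConeInequality_of_weilPositivity hWP)

/-- **`RiemannHypothesis → SignConeInequality`** (unconditional implication: the explicit formula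
`explicit_formula_holds` and the easy half of Weil's criterion are theorems of the tree). [folklore] -/
theorem signConeInequality_of_riemannHypothesis (hRH : RiemannHypothesis) : SignConeInequality :=
  signConeInequality_of_weilPositivity (WeilPositivity.of_riemannHypothesis explicit_formula_holds hRH)

/-- **`RiemannHypothesis → SignConeOscillatory`**: the crux of item stmt-RiemannHypothesis-16302 is
implied by the Riemann hypothesis (so it cannot be refuted short of `¬ RiemannHypothesis`). [folklore] -/
theorem signConeOscillatory_of_riemannHypothesis (hRH : RiemannHypothesis) : SignConeOscillatory :=
  signConeOscillatory_of_signConeInequality (signConeInequality_of_riemannHypothesis hRH)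

/-- `RiemannHypothesis → SignConeFarField`. [folklore] -/
theorem signConeFarField_of_riemannHypothesis (hRH : RiemannHypothesis) : SignConeFarField :=
  signConeFarField_of_signConeInequality (signConeInequality_of_riemannHypothesis hRH)

/-- The crux is sandwiched: `WeilPositivity → SignConeOscillatory`, and `WeilPositivity ↔ RiemannHypothesis`
in the tree (`weil_criterion_holds`); recorded as the implication from either side of Weil's criterion.
[folklore] -/
theorem signConeOscillatory_of_weilPositivity_or_rh (h : WeilPositivity ∨ RiemannHypothesis) :
    SignConeOscillatory :=
  h.elim signConeOscillatory_of_weilPositivity signConeOscillatory_of_riemannHypothesis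

/-! ## The crux in zero-side form

By the explicit formula (`explicit_formula_holds`) the zero side `Z(F) = lim_T Σ_{|Im ρ| ≤ T} m(ρ) F̂(ρ)` of a test
kernel `F` exists and equals `W(F) = W_ar(F) - P_Λ(F)`. Hence the crux is EQUIVALENT to the zero-side
inequality `Re Z(F) ≥ -Re F(0) - Re P_Λ(F)` on the oscillatory node-nonnegative class: Weil positivity
`Re Z(g ⋆ g̃) ≥ 0` (⇔ RH, `weil_criterion_holds`) weakened by the slack `Re F(0) + Re P_Λ(F) ≥ 0` and restricted
to a sub-cone. This is the form any attack on either side must address. -/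

/-- The zero side of a test kernel is unique and equals `W(F)` (explicit formula + uniqueness of limits).
[folklore] -/
theorem eq_weilFunctional_of_hasWeilZeroSide {F : ℝ → ℂ} (hF : IsWeilTest F) {Z : ℂ}
    (hZ : HasWeilZeroSide F Z) : Z = weilFunctional F :=
  tendsto_nhds_unique hZ (explicit_formula_holds hF)

/-- **`SignConeOscillatory` in zero-side form.** The crux holds iff for every cutoff `a > 0`, every finite
family of Weil tests `gᵢ` supported in `[-a, a]` whose autocorrelation sum `F = Σᵢ gᵢ ⋆ g̃ᵢ` is node-nonnegative
and oscillatory, and every zero side `Z` of `F` (`HasWeilZeroSide F Z`; it exists and equals `W(F)` by the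
explicit formula), `-Re F(0) - Re P_Λ(F) ≤ Re Z`. [folklore] -/
theorem signConeOscillatory_iff_zeroSide :
    SignConeOscillatory ↔
      ∀ a : ℝ, 0 < a → ∀ (k : ℕ) (g : Fin k → ℝ → ℂ),
        (∀ i, IsWeilTest (g i) ∧ tsupport (g i) ⊆ Icc (-a) a) →
        let F : ℝ → ℂ := fun t => ∑ i, weilConv (g i) (weilReflect (g i)) t
        (∀ n : ℕ, 2 ≤ n → 0 ≤ (F (Real.log n)).re) → (∃ t : ℝ, Real.log 2 ≤ |t| ∧ (F t).re < 0) →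
        ∀ Z : ℂ, HasWeilZeroSide F Z → -(F 0).re - (weilPrimeTerm F).re ≤ Z.re := by
  constructor
  · intro h a ha k g hg F hn hosc Z hZ
    have hFt : IsWeilTest F :=
      stub_branchesContinuous_isWeilTest_sum _ fun i _ => (hg i).1.weilConv (hg i).1.weilReflect
    have h1 : -(F 0).re ≤ (weilPolarTerm F + weilArchTerm F).re := h a ha k g hg hn hosc
    have hdec : weilPolarTerm F + weilArchTerm F = weilFunctional F + weilPrimeTerm F := by
      unfold weilFunctional
      ring
    rw [hdec, Complex.add_re, ← eq_weilFunctional_of_hasWeilZeroSide hFt hZ] at h1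
    linarith
  · intro h a ha k g hg F hn hosc _M
    have hgi : ∀ i, IsWeilTest (g i) := fun i => (hg i).1
    have hFt : IsWeilTest F :=
      stub_branchesContinuous_isWeilTest_sum _ fun i _ => (hgi i).weilConv (hgi i).weilReflect
    have h1 : -(F 0).re - (weilPrimeTerm F).re ≤ (weilFunctional F).re :=
      h a ha k g hg hn hosc (weilFunctional F) (explicit_formula_holds hFt)
    have hdec : weilPolarTerm F + weilArchTerm F = weilFunctional F + weilPrimeTerm F := by
      unfold weilFunctional
      ring
    have h2 : -(F 0).re ≤ (weilPolarTerm F + weilArchTerm F).re := by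
      rw [hdec, Complex.add_re]
      linarith
    exact h2

end Summit.RiemannHypothesis.RiemannHypothesis.Theorems.SignCone

end
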